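import Summits.QuantumFields.BalabanUV.Beta.FP.TowerFTransportRow
import Summits.QuantumFields.BalabanUV.Beta.FP.StepRecursionFeedNestedCompDoorPairingSummable
import Summits.QuantumFields.BalabanUV.Beta.FP.CompositeOneShotJetDataSymG

/-!
# `BalabanUV.Beta.FP.TowerFTransportRowSymG` — road «FP», THE GRADED TWIN (σ_T) OF R-C1 `FP.TowerFTransportRowSym` (✓ p823510, (c)∕(L-v10) wave R-1), **FILED UNDER director-ym g23
# [DIRYM-G23-INBOX-9] (2026-08-31T17:00:37Z) ruling (1) «located repair σ_T `tabsComp ↦ tabsCompG`» + «`a2` = S-END-G (road, #169 key)»**: R-C1 with the ONE token `WNs ↦ WNsG` — S-L1's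
# second-order family re-read at the GRADED composite tables `tabsCompG` (`CompositeOneShotJetsGraded`; `mixFF = compMixG`, the located word of A2-LOCATE 547291ba ∕ j333652) through
# an2's L-3a `FP.CompositeOneShotJetDataSymG` (✓ p829147: `WNsG`, `vertexFamilies_VNs_WNsG`, `WNsG_translate`, `vertexFamily₂_WNsG`, `loc_WNsG`; the first-order family `VNs` and the chart
# `ANs` are grading-blind and stay S-L1's).  WHY (E-FP-73-3 = E-AN2-94-3, CONFIRMED by an2 W-15∕W-16, chair, director rider #2): the tower whose kernel law closes BY VALUE at (2,3)
# (S2 1.46e−12, D₁⁺ 1.86e−12; `prestab/sym2/STARTED-SYM2` 3b67f41a §Q6) is the GRADED one Nˢʸᵐ(G) (`tabsCompG`), whereas the ungraded typed target R does not close in either convention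
# (`SPAN-SYM2.addendum4` 56c550e9); S-END-G (referee #169's key) consumes THIS file's `htr_recSJG` and `d1Tel_JcS_nestedG_of_fedW_pairingCoclosed_wStep` by name where S-END consumed R-C1's.

CONTENT (every statement = R-C1's under `WNs ↦ WNsG`; every proof R-C1's VERBATIM under {`vertexFamilies_VNs_WNs ↦ vertexFamilies_VNs_WNsG`, `WNs_translate ↦ WNsG_translate`,
`vertexFamily₂_WNs ↦ vertexFamily₂_WNsG`, `loc_WNs ↦ loc_WNsG`}; names = R-C1's with a `G` on the subject token).
* §1 [folklore] **`htr_recSJG (hΨ) (hΨt) (huF)`** = v10's TRANSPORT ROW `htr` (L.277) under option L at the fully-sym GRADED jets `(ANs, VNs, WNsG)`; letters consumed: EXACTLY {`hΨ`, `hΨt`}.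
* §2 [folklore] THE FIVE-FILE `Jc`-END CHAIN under L at the graded jets: `d1Tel_JcS_nestedG_of_hessKer_laws_upTo_wStep` ∕ `…_fedW_wStep` ∕ `…_fedW_moments_wStep` ∕
  `…_fedW_pairingSummable_wStep` ∕ **`d1Tel_JcS_nestedG_of_fedW_pairingCoclosed_wStep`** — the N-system `(ANs, VNs, WNsG)`, a GENERIC one-shot family `Jc` anchored at depth 1 (`hJc1`)
  with its (L2′) row `hN` displayed; the generic cores (`d1Tel_anchored_of_kernel_laws_upTo_wStep`, `law_upTo_of_fedW`, `fineId_of_transport_of_oneShotId`, the moment∕pairing lemmas)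
  are the TREE's, untouched.
WHAT THIS IS NOT: not the graded (b) END (that is `FP.StepRecursionSymEndG.d1Tel_LG_of_hlawLG'`, ✓ p829586, which displays `hlawLG` directly); not S-END-G; 0 defs; [folklore] lemmas over
OUR objects; nothing cited; no `def … : Prop`; 0 sorry.  Nothing of Bałaban's asserted, valued or discharged (ABSOLUTE RULE); 0 estimates; 0∕4 row-D1 binders; NOT (C1), NOT (T-ID),
NOT SDF, NOT D1, NEVER «G-an2-4 closed», NOT BetaPertH, NOT continuum, NOT Clay.

HONEST DEPENDENCY (page 1, mandatory): continuum YM on T⁴ ⇐ BetaPertH ∧ nine spine estimates (0/9 proved); BetaPertH ⇐ (D1) ∧ (D4) ∧ CAP+tail;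
G-an2-4 gates asym, D1 and NE2/3/4.  HONEST FRAMING (cell contract, verbatim): «discharging `BetaPertH` makes Bałaban's UV stability UNCONDITIONAL —
a real constructive-QFT result; it is NOT the continuum limit and NOT the Clay problem.»  ABSOLUTE RULE (cell charter, verbatim): «No internally-minted
statement may enter as a cited fact. Every hypothesis is either kernel-proved in this package or a verbatim quotation of a PUBLISHED theorem with page
reference. The manuscript(s) under audit are NOT citable for their own disputed steps — they are the thing under adjudication; programme-internal
(2001/route/tribunal) claims are never citable.»  Road «FP» OWNER, b2b-balaban-beta-d1-p3 gen 73, 2026-08-31.  No existing file touched.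
-/

noncomputable section

open scoped BigOperators

namespace Summit.QuantumFields.BalabanUV.Beta.FP.TowerFTransportRowSymG

open Finset
open Literature.MathematicalPhysics.QuantumFieldTheory
open Literature.MathematicalPhysics.QuantumFieldTheory.Balaban1983to89
open Literature.MathematicalPhysics.QuantumFieldTheory.Balaban1983to89.Beta
open B12Sec2to5 (l1 l1_nonneg)
open AffineAveraging (toSite)
open ExpKernelCalculus (Site MKer Decays BiLoc VertexFamily VertexFamily₂ shiftK hessKer bubble tadpole comp comp_shiftK)
open DressedMomentNormalisation (EKer dressedEntry)
open HessKerRate (scaleK hessKer_scaleK biLoc_scaleK)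
open KernelReflection (bubble_smul_left bubble_smul_right tadpole_smul)
open HessianTelescopingKKT (wStep)
open OneStepResolventKernel (Fib KInv JetData LocStencil biLoc_mono shiftK_KInv)
open OneStepKernelFamily (vertexOfK vertexFamily_vertexOfK')
open BalabanStepJets (vertexFamily₂_mono)
open BalabanStepJetsSucc (vertexOfK_translate_block)
open Summit.QuantumFields.BalabanUV.Beta.TameKernelCalculus (Spr trK Spr.trK)
open Summit.QuantumFields.BalabanUV.Beta.ChartConjugationRelative (spr_comp)
open Summit.QuantumFields.BalabanUV.Beta.AxialDressingRooted (one_le_of_neZero coDressKBmAt spr_coDressKBmAt shiftK_coDressKBmAt trK_shiftK)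
open Summit.QuantumFields.BalabanUV.Beta.BorderedHessian (spr_KInv)
open Summit.QuantumFields.BalabanUV.Beta.CompositeCorrectorKernel (psiK shiftK_neg_psiK)
open Summit.QuantumFields.BalabanUV.Beta.ChartStepJets (JsChart0Of JsChart0Of_S JsChart0Of_W JsChart0Of_S_translate JsChart0Of_W_translate locStencil_SchartOf vertexFamily₂_WchartOf)
open Summit.QuantumFields.BalabanUV.Beta.CompositeOneShotJets (tabsComp)
open Summit.QuantumFields.BalabanUV.Beta.CompositeOneShotJetData (Roots Pins AN VN WN AN_eq VN_eq WN_eq JNat JNat_eq JNat_S JNat_W)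
open Summit.QuantumFields.BalabanUV.Beta.FP.NestedConstraintScaling (fibreScale_mul_inv)
open Summit.QuantumFields.BalabanUV.Beta.FP.KernelStepDressing (dressV dressW)
open Summit.QuantumFields.BalabanUV.Beta.FP.KernelStepDressingHessKer (hessKer_dressV_dressW)
open Summit.QuantumFields.BalabanUV.Beta.FP.TowerFTransportRow (abs_wStep_le htr_rec)
open Summit.QuantumFields.BalabanUV.Beta.VertexSandwichTransport (decays_of_spr)
open DecimatedMomentSummable (AbsMoment₂)
open DressedMomentNormalisation (m2Tensor)
open OneStepKernelFamily (TshotOf TbalOf D1Tel)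
open Literature.MathematicalPhysics.QuantumFieldTheory.Balaban1983to89.B12Sec2to5 (abs_coord_le_l1)
open Summit.QuantumFields.BalabanUV.Beta.TameKernelCalculus (Loc)
open Summit.QuantumFields.BalabanUV.Beta.SymSecondOrderTablesAn1 (symTablesAn1S2)
open Summit.QuantumFields.BalabanUV.Beta.CombChartJointEnd (JsB12CombShSym)
open Summit.QuantumFields.BalabanUV.Beta.CombOneShotJets (JcOf)
open Summit.QuantumFields.BalabanUV.Beta.CompositeOneShotJetData (JcComp)
open Summit.QuantumFields.BalabanUV.Beta.GAN24.WSlotParityBlind (loc_of_vertexFamily₂)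
open Summit.QuantumFields.BalabanUV.Beta.FP.PerfectBubbleExpansion (absMoment₂_tadpolePart)
open Summit.QuantumFields.BalabanUV.Beta.FP.StepRecursionFeedNested (fineId_of_transport_of_oneShotId)
open Summit.QuantumFields.BalabanUV.Beta.FP.StepRecursionFeedNestedCompUpTo (d1Tel_anchored_of_kernel_laws_upTo_wStep)
open Summit.QuantumFields.BalabanUV.Beta.FP.StepRecursionFeedNestedCompDoor (law_upTo_of_fedW)
open Summit.QuantumFields.BalabanUV.Beta.FP.StepRecursionFeedNestedCompDoorMoments
  (absMoment₂_tadpoleDefect hasSum_const_mul_of_tsum_eq_zero hasSum_coord_smul_of_tsum_eq_zero m2Tensor_eq_zero_of_tsum_coord2)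
open Summit.QuantumFields.BalabanUV.Beta.FP.StepRecursionFeedNestedCompDoorPairing (tsum_weight_tadpole_eq_zero_of_hasSum)
open Summit.QuantumFields.BalabanUV.Beta.FP.TowerK2bDoorPairingSummable
  (tsum_symPairing_eq_zero tsum_firstMoment_symPairing_eq_zero_of_colSums_eq_zero tsum_secondMoment_symPairing_eq_zero_of_dipoles_eq_zero)
open Summit.QuantumFields.BalabanUV.Beta.FP.TowerK2bDoorReadoutSummable (tsum_col_eq_zero_of_coclosed tsum_dipoles_eq_zero_of_coclosed_of_reflect)
open Summit.QuantumFields.BalabanUV.Beta.FP.StepRecursionFeedNestedCompDoorPairingSummable (abs_coordHom_le_l1 tsum_tadpole_eq_zero_of_tsum)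

open Summit.QuantumFields.BalabanUV.Beta.FP.CompositeOneShotJetDataSym (ANs VNs spr_ANs shiftK_ANs_smul VNs_translate)
open Summit.QuantumFields.BalabanUV.Beta.FP.CompositeOneShotJetDataSymG (WNsG vertexFamilies_VNs_WNsG WNsG_translate vertexFamily₂_WNsG loc_WNsG)

/-! ## §1 `htr` UNDER OPTION L AT THE FULLY-SYM JETS — a THEOREM modulo exactly {`hΨ`, `hΨt`} -/

section TransportLSym

variable (Lc : ℕ) [NeZero Lc] (Ψs : ℕ → MKer (3 + 1) (Fib 3)) (hΨ : ∀ m, Spr (Ψs m)) (Pn : Pins) (uF : ℕ → ℝ)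

/-- [folklore] **`htr_recSJ` — v10's TRANSPORT ROW `htr` (L.277) UNDER OPTION L AT THE FULLY-SYM JETS**, under `TowerFTransportRow.htr_rec`'s σ with
`AN (Roots.ctr Lc) j ↦ ANs (Roots.ctr Lc) Ψs j`, `VN ↦ VNs`, `WN ↦ WNsG`: `htr_rec`'s PROOF VERBATIM with its two chart facts (`decays_AN ↦ spr_ANs`, `shiftK_AN_smul ↦ shiftK_ANs_smul`)
and its four jet letters (`vertexFamilies_VN_WN ↦ vertexFamilies_VNs_WNsG`, `VN_translate ↦ VNs_translate`, `WN_translate ↦ WNsG_translate`) swapped — letters {`hΨ`, `hΨt`} and nothing else. -/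
theorem htr_recSJG (hΨt : ∀ (j : ℕ) (t : Site (3 + 1)), shiftK (-(((Lc ^ (j + 1) : ℕ) : ℤ) • t)) (Ψs (j + 1)) = Ψs (j + 1))
    (huF : ∀ j, uF j ≠ 0) : ∀ j : ℕ, 1 ≤ j → ∀ (μ ν : Fin 4) (z : Fin 4 → ℤ), hessKer (scaleK (Sum.elim (fun _ : Fin (3 + 1) => (1 : ℝ)) (fun _ : Fin (3 + 1) => (uF j)⁻¹)) (Sum.elim (fun _ : Fin (3 + 1) => (1 : ℝ)) (fun _ : Fin (3 + 1) => (uF j)⁻¹)) (ANs (Roots.ctr Lc) Ψs j)) (fun μ y => scaleK (Sum.elim (fun _ : Fin (3 + 1) => (1 : ℝ)) (fun _ : Fin (3 + 1) => (uF j))) (Sum.elim (fun _ : Fin (3 + 1) => (1 : ℝ)) (fun _ : Fin (3 + 1) => (uF j))) ((Lc : ℝ) ^ 4 • dressV (Lc ^ (j + 1)) Lc (wStep Lc (j + 1)) (VNs (Roots.ctr Lc) Ψs hΨ Pn j) μ y)) (fun μ y ν y' => scaleK (Sum.elim (fun _ : Fin (3 + 1) => (1 : ℝ)) (fun _ : Fin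 (3 + 1) => (uF j))) (Sum.elim (fun _ : Fin (3 + 1) => (1 : ℝ)) (fun _ : Fin (3 + 1) => (uF j))) ((Lc : ℝ) ^ 8 • dressW (Lc ^ (j + 1)) Lc (wStep Lc (j + 1)) (WNsG (Roots.ctr Lc) Ψs hΨ Pn j) μ y ν y')) μ ν z = (Lc : ℝ) ^ 8 * dressedEntry (wStep Lc (j + 1)) (hessKer (ANs (Roots.ctr Lc) Ψs j) (VNs (Roots.ctr Lc) Ψs hΨ Pn j) (WNsG (Roots.ctr Lc) Ψs hΨ Pn j)) ((Lc : ℤ) • z) μ ν := by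
  intro j _ μ ν z
  have hσσ : ∀ a : Fib 3, Sum.elim (fun _ : Fin (3 + 1) => (1 : ℝ)) (fun _ : Fin (3 + 1) => (uF j)⁻¹) a
      * Sum.elim (fun _ : Fin (3 + 1) => (1 : ℝ)) (fun _ : Fin (3 + 1) => (uF j)) a = 1 := fun a => fibreScale_mul_inv (huF j) a
  rw [hessKer_scaleK _ _ hσσ (ANs (Roots.ctr Lc) Ψs j)
    (fun μ y => (Lc : ℝ) ^ 4 • dressV (Lc ^ (j + 1)) Lc (wStep Lc (j + 1)) (VNs (Roots.ctr Lc) Ψs hΨ Pn j) μ y)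
    (fun μ y ν y' => (Lc : ℝ) ^ 8 • dressW (Lc ^ (j + 1)) Lc (wStep Lc (j + 1)) (WNsG (Roots.ctr Lc) Ψs hΨ Pn j) μ y ν y')]
  -- the L-chart's letters and the sym jets' letters (S-L1 `FP.CompositeOneShotJetDataSym`)
  obtain ⟨Cv, Cw, δ, hδ, hV, hW⟩ := vertexFamilies_VNs_WNsG (Roots.ctr Lc) Ψs hΨ Pn j
  obtain ⟨δw, Cw0, hδw, hCw0, hw⟩ := abs_wStep_le Lc (j + 1)
  have hid := hessKer_dressV_dressW (N := Lc ^ (j + 1)) Lc (w := wStep Lc (j + 1)) (A := ANs (Roots.ctr Lc) Ψs j)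
    (V := VNs (Roots.ctr Lc) Ψs hΨ Pn j) (W := WNsG (Roots.ctr Lc) Ψs hΨ Pn j) (spr_ANs (Roots.ctr Lc) Ψs hΨ j) (shiftK_ANs_smul (Roots.ctr Lc) Ψs j (hΨt j))
    (fun c a u => hw c a u) hCw0 hδw hV hW hδ (VNs_translate (Roots.ctr Lc) Ψs hΨ Pn j (hΨt j)) (WNsG_translate (Roots.ctr Lc) Ψs hΨ Pn j (hΨt j)) μ ν z
  rw [← hid]
  simp only [ExpKernelCalculus.hessKer]
  rw [tadpole_smul, bubble_smul_left, bubble_smul_right]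
  ring

/- (II) CONTROL of the ungraded file (`simp only [ANs_psiK, VNs_psiK, WNs_psiK]; exact htr_rec …`) has no graded analogue: the GRADED second-order family `WNsG` is
S-L1's `WNs` with `tabsComp ↦ tabsCompG` (`CompositeOneShotJetsGraded`), and the tree's record row `TowerFTransportRow.htr_rec` is stated at the UNGRADED record `WN`; the
junction with the ungraded file is the token map `WNs ↦ WNsG` itself (statement and proof otherwise character for character). -/

end TransportLSym


/-! ## §2 THE FIVE-FILE `JcComp`-END CHAIN UNDER OPTION L — v10's terminal supplier `d1Tel_JcComp_nested_of_fedW_pairingCoclosed_wStep` and its four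
predecessors (`…CompUpTo` §2, `…CompDoor` §2, `…CompDoorMoments` §2, `…CompDoorPairingSummable` §2∕§5), RE-POINTED to the fully-sym N-system
`(ANs, VNs, WNsG)` and a GENERIC one-shot family `Jc` ANCHORED at depth 1 (`hJc1`, as #28 §5) with its (L2′) row `hN` DISPLAYED (S-L3a `TowerKernelLawNamedSym.hN_JcSym` at
`Jc := JcSym … JN`; row F-L5 `vertexOfK_conj_psiKSym` makes its `hadj` letter a theorem at `psiKSym`).  Every statement = the tree's with `AN ↦ ANs`, `VN ↦ VNs`, `WN ↦ WNsG`,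
`JcComp … ↦ Jc`; every proof the tree's VERBATIM with `spr_AN ↦ spr_ANs hΨ`, `loc_WN ↦ loc_WNsG` (S-L1), `hN_JcComp ↦ hN`,
`JcComp_one ↦ hJc1`; the generic cores (`d1Tel_anchored_of_kernel_laws_upTo_wStep`, `law_upTo_of_fedW`, `fineId_of_transport_of_oneShotId`, the moment∕pairing
lemmas) are the TREE's, untouched — CENSUS-L-END's PULL∕`JcComp` nodes are thin re-pointings (letters {hΨ} + the displayed `hN`, `hJc1`). -/

section EndChainL

variable {Lc : ℕ} [NeZero Lc] {FF FG : Type*} [Fintype FF] [Fintype FG]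
variable {V : ℕ → Type*} [∀ j, AddCommGroup (V j)] [∀ j, Module ℝ (V j)]

/-- [folklore] **ROOT M‴'s `htel` AT THE RECORD PAIR, NESTED CURRENCY, ON THE PRICED BRANCH.**  #31 `d1Tel_JcS_nestedG_of_hessKer_laws_wStep` with the
kernel law per storey `j ≥ 1` carrying a DISPLAYED defect family `D j` (`hlaw : hessKer N_j = hessKer F_j + hessKer G_j + D j μ ν z` at an2's N-system
`(ANs R Ψs j, VNs R Ψs hΨ P j, WNsG R Ψs hΨ P j)`), the ANCHOR storey's fine identification `hF₁`, the TRANSPORT clause `htr`, the top-step identification `hG`, (T0)(T1)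
— VERBATIM — and an4's four remainder binders on `D` (`hD0 hD1 hDA hD2`, `j ≥ 1`) ⟹ `D1Tel Lc Js (JcComp hLc N cΛ cB R P)`; `hN := hN_JcComp`,
`hJc1 := JcComp_one`.  `D := 0` is #31. -/
theorem d1Tel_JcS_nestedG_of_hessKer_laws_upTo_wStep (hLc : Odd Lc) (N : ℕ) (cΛ cB : ℝ) (R : Roots Lc) (Ψs : ℕ → MKer (3 + 1) (Fib 3)) (hΨ : ∀ m, Spr (Ψs m)) (P : Pins)
    (Jc : ∀ m : ℕ, JetData 3 (Lc ^ m)) (hJc1 : Jc 1 = JcOf hLc N (fun _ => cΛ) (fun _ => cB) 1)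
    (hN : ∀ j : ℕ, 1 ≤ j → ∀ (a b : Fin 4) (z : Fin 4 → ℤ), hessKer (ANs R Ψs j) (VNs R Ψs hΨ P j) (WNsG R Ψs hΨ P j) a b z = TshotOf Lc Jc (j + 1) a b z)
    (AF : ℕ → MKer 4 FF) (𝒱F : ℕ → Fin 4 → (Fin 4 → ℤ) → MKer 4 FF) (𝒲F : ℕ → Fin 4 → (Fin 4 → ℤ) → Fin 4 → (Fin 4 → ℤ) → MKer 4 FF)
    (AG : ℕ → MKer 4 FG) (𝒱G : ℕ → Fin 4 → (Fin 4 → ℤ) → MKer 4 FG) (𝒲G : ℕ → Fin 4 → (Fin 4 → ℤ) → Fin 4 → (Fin 4 → ℤ) → MKer 4 FG)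
    (D : ℕ → EKer 4)
    (hlaw : ∀ j : ℕ, 1 ≤ j → ∀ (μ ν : Fin 4) (z : Fin 4 → ℤ),
      hessKer (ANs R Ψs j) (VNs R Ψs hΨ P j) (WNsG R Ψs hΨ P j) μ ν z
        = hessKer (AF j) (𝒱F j) (𝒲F j) μ ν z + hessKer (AG j) (𝒱G j) (𝒲G j) μ ν z + D j μ ν z)
    (hF₁ : ∀ (μ ν : Fin 4) (z : Fin 4 → ℤ),
      hessKer (AF 1) (𝒱F 1) (𝒲F 1) μ ν z
        = (Lc : ℝ) ^ 8 * dressedEntry (wStep Lc 1) (TshotOf Lc Jc 1) ((Lc : ℤ) • z) μ ν)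
    (htr : ∀ j : ℕ, 1 ≤ j → ∀ (μ ν : Fin 4) (z : Fin 4 → ℤ),
      hessKer (AF (j + 1)) (𝒱F (j + 1)) (𝒲F (j + 1)) μ ν z
        = (Lc : ℝ) ^ 8 * dressedEntry (wStep Lc (j + 1)) (hessKer (ANs R Ψs j) (VNs R Ψs hΨ P j) (WNsG R Ψs hΨ P j)) ((Lc : ℤ) • z) μ ν)
    (hG : ∀ j : ℕ, 1 ≤ j → ∀ (μ ν : Fin 4) (z : Fin 4 → ℤ),
      hessKer (AG j) (𝒱G j) (𝒲G j) μ ν z = TbalOf Lc (JsB12CombShSym hLc N (symTablesAn1S2 3 Lc cΛ) cΛ cB) j μ ν z)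
    (hT0 : ∀ j (c e : Fin 4), HasSum (TbalOf Lc (JsB12CombShSym hLc N (symTablesAn1S2 3 Lc cΛ) cΛ cB) j c e) 0)
    (hT1 : ∀ j (c e ρ : Fin 4), HasSum (fun t : Fin 4 → ℤ => t ρ • TbalOf Lc (JsB12CombShSym hLc N (symTablesAn1S2 3 Lc cΛ) cΛ cB) j c e t) 0)
    (hD0 : ∀ j, 1 ≤ j → ∀ c e : Fin 4, HasSum (D j c e) 0)
    (hD1 : ∀ j, 1 ≤ j → ∀ c e ρ : Fin 4, HasSum (fun t : Fin 4 → ℤ => t ρ • D j c e t) 0)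
    (hDA : ∀ j, 1 ≤ j → ∀ c e : Fin 4, AbsMoment₂ (D j c e)) (hD2 : ∀ j, 1 ≤ j → m2Tensor (D j) = 0) :
    D1Tel Lc (JsB12CombShSym hLc N (symTablesAn1S2 3 Lc cΛ) cΛ cB) Jc := by
  refine d1Tel_anchored_of_kernel_laws_upTo_wStep hLc N cΛ cB Jc hJc1
    (fun j => hessKer (ANs R Ψs j) (VNs R Ψs hΨ P j) (WNsG R Ψs hΨ P j)) (fun j => hessKer (AF j) (𝒱F j) (𝒲F j)) (fun j => hessKer (AG j) (𝒱G j) (𝒲G j)) D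
    hlaw hN ?_ hG hT0 hT1 hD0 hD1 hDA hD2
  intro j hj
  match j, hj with
  | 1, _ => exact hF₁
  | j + 2, _ =>
    exact fineId_of_transport_of_oneShotId (𝒯 := TshotOf Lc Jc) (w := wStep Lc)
      (fun j => hessKer (ANs R Ψs j) (VNs R Ψs hΨ P j) (WNsG R Ψs hΨ P j)) (fun j => hessKer (AF j) (𝒱F j) (𝒲F j)) (j + 1)
      (hN (j + 1) (Nat.succ_pos j)) (htr (j + 1) (Nat.succ_pos j))

/-- [folklore] **ROOT M‴'s `htel` AT THE RECORD PAIR, NESTED CURRENCY, THE DOOR FED AS N-DATA** (SPEC-64 §10 (ii-A″), `…CompUpTo` shape).  DISPLAYED: the door family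
`𝒲Δ j` with its localisation letter `hWΔ`; the kernel law FOR THE FED FAMILY `hlawΔ : hessKer (ANs R Ψs j) (VNs R Ψs hΨ P j) (WNsG R Ψs hΨ P j + 𝒲Δ j) μ ν z = hessKer F_j + hessKer G_j`
(`j ≥ 1`); #31's `hF₁ htr hG` (T0)(T1) VERBATIM; an4's four remainder binders ON THE TADPOLE DEFECT `D j μ ν z := −½·tadpole (ANs R Ψs j) (𝒲Δ j μ 0 ν z)`, `j ≥ 1`
⟹ `D1Tel Lc Js (JcComp hLc N cΛ cB R P)`.  The N-leg's `Spr` and the record family's `Loc` are an2's theorems (inside). -/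
theorem d1Tel_JcS_nestedG_of_hessKer_laws_fedW_wStep (hLc : Odd Lc) (N : ℕ) (cΛ cB : ℝ) (R : Roots Lc) (Ψs : ℕ → MKer (3 + 1) (Fib 3)) (hΨ : ∀ m, Spr (Ψs m)) (P : Pins)
    (Jc : ∀ m : ℕ, JetData 3 (Lc ^ m)) (hJc1 : Jc 1 = JcOf hLc N (fun _ => cΛ) (fun _ => cB) 1)
    (hN : ∀ j : ℕ, 1 ≤ j → ∀ (a b : Fin 4) (z : Fin 4 → ℤ), hessKer (ANs R Ψs j) (VNs R Ψs hΨ P j) (WNsG R Ψs hΨ P j) a b z = TshotOf Lc Jc (j + 1) a b z)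
    (AF : ℕ → MKer 4 FF) (𝒱F : ℕ → Fin 4 → (Fin 4 → ℤ) → MKer 4 FF) (𝒲F : ℕ → Fin 4 → (Fin 4 → ℤ) → Fin 4 → (Fin 4 → ℤ) → MKer 4 FF)
    (AG : ℕ → MKer 4 FG) (𝒱G : ℕ → Fin 4 → (Fin 4 → ℤ) → MKer 4 FG) (𝒲G : ℕ → Fin 4 → (Fin 4 → ℤ) → Fin 4 → (Fin 4 → ℤ) → MKer 4 FG)
    -- THE DOOR FAMILY, DISPLAYED AS DATA, with its localisation letter
    (𝒲Δ : ℕ → Fin (3 + 1) → Site (3 + 1) → Fin (3 + 1) → Site (3 + 1) → MKer (3 + 1) (Fib 3))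
    (hWΔ : ∀ (j : ℕ) (μ : Fin (3 + 1)) (ν : Fin (3 + 1)) (z : Site (3 + 1)), Loc (𝒲Δ j μ 0 ν z))
    -- THE KERNEL LAW FOR THE FED FAMILY (N-side placement)
    (hlawΔ : ∀ j : ℕ, 1 ≤ j → ∀ (μ ν : Fin 4) (z : Fin 4 → ℤ),
      hessKer (ANs R Ψs j) (VNs R Ψs hΨ P j) (WNsG R Ψs hΨ P j + 𝒲Δ j) μ ν z
        = hessKer (AF j) (𝒱F j) (𝒲F j) μ ν z + hessKer (AG j) (𝒱G j) (𝒲G j) μ ν z)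
    (hF₁ : ∀ (μ ν : Fin 4) (z : Fin 4 → ℤ),
      hessKer (AF 1) (𝒱F 1) (𝒲F 1) μ ν z
        = (Lc : ℝ) ^ 8 * dressedEntry (wStep Lc 1) (TshotOf Lc Jc 1) ((Lc : ℤ) • z) μ ν)
    (htr : ∀ j : ℕ, 1 ≤ j → ∀ (μ ν : Fin 4) (z : Fin 4 → ℤ),
      hessKer (AF (j + 1)) (𝒱F (j + 1)) (𝒲F (j + 1)) μ ν z
        = (Lc : ℝ) ^ 8 * dressedEntry (wStep Lc (j + 1)) (hessKer (ANs R Ψs j) (VNs R Ψs hΨ P j) (WNsG R Ψs hΨ P j)) ((Lc : ℤ) • z) μ ν)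
    (hG : ∀ j : ℕ, 1 ≤ j → ∀ (μ ν : Fin 4) (z : Fin 4 → ℤ),
      hessKer (AG j) (𝒱G j) (𝒲G j) μ ν z = TbalOf Lc (JsB12CombShSym hLc N (symTablesAn1S2 3 Lc cΛ) cΛ cB) j μ ν z)
    (hT0 : ∀ j (c e : Fin 4), HasSum (TbalOf Lc (JsB12CombShSym hLc N (symTablesAn1S2 3 Lc cΛ) cΛ cB) j c e) 0)
    (hT1 : ∀ j (c e ρ : Fin 4), HasSum (fun t : Fin 4 → ℤ => t ρ • TbalOf Lc (JsB12CombShSym hLc N (symTablesAn1S2 3 Lc cΛ) cΛ cB) j c e t) 0)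
    -- an4's REMAINDER BINDERS ON THE TADPOLE DEFECT
    (hD0 : ∀ j, 1 ≤ j → ∀ c e : Fin 4, HasSum (fun z : Fin 4 → ℤ => -(1 / 2 : ℝ) * tadpole (ANs R Ψs j) (𝒲Δ j c 0 e z)) 0)
    (hD1 : ∀ j, 1 ≤ j → ∀ c e ρ : Fin 4, HasSum (fun z : Fin 4 → ℤ => z ρ • (-(1 / 2 : ℝ) * tadpole (ANs R Ψs j) (𝒲Δ j c 0 e z))) 0)
    (hDA : ∀ j, 1 ≤ j → ∀ c e : Fin 4, AbsMoment₂ (fun z : Fin 4 → ℤ => -(1 / 2 : ℝ) * tadpole (ANs R Ψs j) (𝒲Δ j c 0 e z)))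
    (hD2 : ∀ j, 1 ≤ j → m2Tensor (fun c e z => -(1 / 2 : ℝ) * tadpole (ANs R Ψs j) (𝒲Δ j c 0 e z)) = 0) :
    D1Tel Lc (JsB12CombShSym hLc N (symTablesAn1S2 3 Lc cΛ) cΛ cB) Jc :=
  d1Tel_JcS_nestedG_of_hessKer_laws_upTo_wStep hLc N cΛ cB R Ψs hΨ P Jc hJc1 hN AF 𝒱F 𝒲F AG 𝒱G 𝒲G
    (fun j c e z => -(1 / 2 : ℝ) * tadpole (ANs R Ψs j) (𝒲Δ j c 0 e z))
    (fun j hj μ ν z => law_upTo_of_fedW (spr_ANs R Ψs hΨ j) (VNs R Ψs hΨ P j) μ ν z (loc_WNsG R Ψs hΨ P j μ 0 ν z) (hWΔ j μ ν z) (hlawΔ j hj μ ν z))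
    hF₁ htr hG hT0 hT1 hD0 hD1 hDA hD2

/-- [folklore] **ROOT M‴'s `htel` AT THE RECORD PAIR, NESTED CURRENCY, THE DOOR A LOCALISED FAMILY, THE BINDER ITS TADPOLE's FOLDS** (SPEC-64 §10 (ii-A″)+(3),
`…CompDoor` §2 shape).  DISPLAYED: the door family `𝒲Δ j` with its letter IN THE N-SIDE's SHAPE `hWΔ₂ : ∃ Cw δw, 0 < δw ∧ VertexFamily₂ (𝒲Δ j) (Lc^(j+1)) Cw δw`;
the kernel law FOR THE FED FAMILY `hlawΔ`; #31's `hF₁ htr hG` (T0)(T1) VERBATIM; and THE THREE LATTICE FOLDS OF THE RAW DOOR TADPOLE at every storey `j ≥ 1` —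
`hM0 : ∑' z, tadpole (ANs R Ψs j) (𝒲Δ j c 0 e z) = 0`, `hM1 : ∑' z, z_ρ·(…) = 0`, `hM2 : ∑' z, z_κ z_λ·(…) = 0` — ⟹ `D1Tel Lc Js (JcComp hLc N cΛ cB R P)`.
`Loc` of the members and an4's `hDA` are theorems (inside, §1). -/
theorem d1Tel_JcS_nestedG_of_fedW_moments_wStep (hLc : Odd Lc) (N : ℕ) (cΛ cB : ℝ) (R : Roots Lc) (Ψs : ℕ → MKer (3 + 1) (Fib 3)) (hΨ : ∀ m, Spr (Ψs m)) (P : Pins)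
    (Jc : ∀ m : ℕ, JetData 3 (Lc ^ m)) (hJc1 : Jc 1 = JcOf hLc N (fun _ => cΛ) (fun _ => cB) 1)
    (hN : ∀ j : ℕ, 1 ≤ j → ∀ (a b : Fin 4) (z : Fin 4 → ℤ), hessKer (ANs R Ψs j) (VNs R Ψs hΨ P j) (WNsG R Ψs hΨ P j) a b z = TshotOf Lc Jc (j + 1) a b z)
    (AF : ℕ → MKer 4 FF) (𝒱F : ℕ → Fin 4 → (Fin 4 → ℤ) → MKer 4 FF) (𝒲F : ℕ → Fin 4 → (Fin 4 → ℤ) → Fin 4 → (Fin 4 → ℤ) → MKer 4 FF)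
    (AG : ℕ → MKer 4 FG) (𝒱G : ℕ → Fin 4 → (Fin 4 → ℤ) → MKer 4 FG) (𝒲G : ℕ → Fin 4 → (Fin 4 → ℤ) → Fin 4 → (Fin 4 → ℤ) → MKer 4 FG)
    -- THE DOOR FAMILY, DISPLAYED AS DATA, with its localisation letter IN THE N-SIDE's SHAPE
    (𝒲Δ : ℕ → Fin (3 + 1) → Site (3 + 1) → Fin (3 + 1) → Site (3 + 1) → MKer (3 + 1) (Fib 3))
    (hWΔ₂ : ∀ j : ℕ, ∃ Cw δw : ℝ, 0 < δw ∧ VertexFamily₂ (𝒲Δ j) (Lc ^ (j + 1)) Cw δw)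
    -- THE KERNEL LAW FOR THE FED FAMILY (N-side placement)
    (hlawΔ : ∀ j : ℕ, 1 ≤ j → ∀ (μ ν : Fin 4) (z : Fin 4 → ℤ),
      hessKer (ANs R Ψs j) (VNs R Ψs hΨ P j) (WNsG R Ψs hΨ P j + 𝒲Δ j) μ ν z
        = hessKer (AF j) (𝒱F j) (𝒲F j) μ ν z + hessKer (AG j) (𝒱G j) (𝒲G j) μ ν z)
    (hF₁ : ∀ (μ ν : Fin 4) (z : Fin 4 → ℤ),
      hessKer (AF 1) (𝒱F 1) (𝒲F 1) μ ν z
        = (Lc : ℝ) ^ 8 * dressedEntry (wStep Lc 1) (TshotOf Lc Jc 1) ((Lc : ℤ) • z) μ ν)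
    (htr : ∀ j : ℕ, 1 ≤ j → ∀ (μ ν : Fin 4) (z : Fin 4 → ℤ),
      hessKer (AF (j + 1)) (𝒱F (j + 1)) (𝒲F (j + 1)) μ ν z
        = (Lc : ℝ) ^ 8 * dressedEntry (wStep Lc (j + 1)) (hessKer (ANs R Ψs j) (VNs R Ψs hΨ P j) (WNsG R Ψs hΨ P j)) ((Lc : ℤ) • z) μ ν)
    (hG : ∀ j : ℕ, 1 ≤ j → ∀ (μ ν : Fin 4) (z : Fin 4 → ℤ),
      hessKer (AG j) (𝒱G j) (𝒲G j) μ ν z = TbalOf Lc (JsB12CombShSym hLc N (symTablesAn1S2 3 Lc cΛ) cΛ cB) j μ ν z)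
    (hT0 : ∀ j (c e : Fin 4), HasSum (TbalOf Lc (JsB12CombShSym hLc N (symTablesAn1S2 3 Lc cΛ) cΛ cB) j c e) 0)
    (hT1 : ∀ j (c e ρ : Fin 4), HasSum (fun t : Fin 4 → ℤ => t ρ • TbalOf Lc (JsB12CombShSym hLc N (symTablesAn1S2 3 Lc cΛ) cΛ cB) j c e t) 0)
    -- THE THREE LATTICE FOLDS OF THE RAW DOOR TADPOLE (SPEC-64 §10 (3): M0Δ, M1Δ, M2Δ), every storey
    (hM0 : ∀ j, 1 ≤ j → ∀ c e : Fin 4, ∑' z : Fin 4 → ℤ, tadpole (ANs R Ψs j) (𝒲Δ j c 0 e z) = 0)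
    (hM1 : ∀ j, 1 ≤ j → ∀ c e ρ : Fin 4, ∑' z : Fin 4 → ℤ, (z ρ : ℝ) * tadpole (ANs R Ψs j) (𝒲Δ j c 0 e z) = 0)
    (hM2 : ∀ j, 1 ≤ j → ∀ κ l c e : Fin 4, ∑' z : Fin 4 → ℤ, ((z κ : ℝ) * (z l : ℝ)) * tadpole (ANs R Ψs j) (𝒲Δ j c 0 e z) = 0) :
    D1Tel Lc (JsB12CombShSym hLc N (symTablesAn1S2 3 Lc cΛ) cΛ cB) Jc :=
  d1Tel_JcS_nestedG_of_hessKer_laws_fedW_wStep hLc N cΛ cB R Ψs hΨ P Jc hJc1 hN AF 𝒱F 𝒲F AG 𝒱G 𝒲G 𝒲Δ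
    (fun j μ ν z => by
      obtain ⟨Cw, δw, hδw, hW⟩ := hWΔ₂ j
      exact loc_of_vertexFamily₂ hW hδw μ 0 ν z)
    hlawΔ hF₁ htr hG hT0 hT1
    (fun j hj c e => hasSum_const_mul_of_tsum_eq_zero (absMoment₂_tadpolePart (spr_ANs R Ψs hΨ j) (hWΔ₂ j) (Nat.one_le_pow _ _ (Nat.pos_of_neZero Lc)) c e) (hM0 j hj c e) _)
    (fun j hj c e ρ => hasSum_coord_smul_of_tsum_eq_zero (absMoment₂_tadpolePart (spr_ANs R Ψs hΨ j) (hWΔ₂ j) (Nat.one_le_pow _ _ (Nat.pos_of_neZero Lc)) c e) ρ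
      (hM1 j hj c e ρ) _)
    (fun j _ c e => absMoment₂_tadpoleDefect (spr_ANs R Ψs hΨ j) (hWΔ₂ j) (Nat.one_le_pow _ _ (Nat.pos_of_neZero Lc)) _ c e)
    (fun j hj => m2Tensor_eq_zero_of_tsum_coord2 (T := fun c e z => tadpole (ANs R Ψs j) (𝒲Δ j c 0 e z)) (fun κ l c e => hM2 j hj κ l c e) _)

/-- [folklore] **THE PER-STOREY SHAPE, SUMMABLE CUT** (p659244 §2 shape; general roots `Rt`; NO covariance row): at EVERY storey `j ≥ 1` the pairing data `S j`, `τ j`, `lam j` (space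
`V j`), covariance, `hSa hτa`, (U) `hΘ j`, `hS0 j`, `hS1 j`, `hX j`; coordinates `c ρ` storey-free. -/
theorem d1Tel_JcS_nestedG_of_fedW_pairingSummable_wStep (hLc : Odd Lc) (N : ℕ) (cΛ cB : ℝ) (Rt : Roots Lc) (Ψs : ℕ → MKer (3 + 1) (Fib 3)) (hΨ : ∀ m, Spr (Ψs m)) (P : Pins)
    (Jc : ∀ m : ℕ, JetData 3 (Lc ^ m)) (hJc1 : Jc 1 = JcOf hLc N (fun _ => cΛ) (fun _ => cB) 1)
    (hN : ∀ j : ℕ, 1 ≤ j → ∀ (a b : Fin 4) (z : Fin 4 → ℤ), hessKer (ANs Rt Ψs j) (VNs Rt Ψs hΨ P j) (WNsG Rt Ψs hΨ P j) a b z = TshotOf Lc Jc (j + 1) a b z)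
    (AF : ℕ → MKer 4 FF) (𝒱F : ℕ → Fin 4 → (Fin 4 → ℤ) → MKer 4 FF) (𝒲F : ℕ → Fin 4 → (Fin 4 → ℤ) → Fin 4 → (Fin 4 → ℤ) → MKer 4 FF)
    (AG : ℕ → MKer 4 FG) (𝒱G : ℕ → Fin 4 → (Fin 4 → ℤ) → MKer 4 FG) (𝒲G : ℕ → Fin 4 → (Fin 4 → ℤ) → Fin 4 → (Fin 4 → ℤ) → MKer 4 FG)
    (𝒲Δ : ℕ → Fin (3 + 1) → Site (3 + 1) → Fin (3 + 1) → Site (3 + 1) → MKer (3 + 1) (Fib 3))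
    (hWΔ₂ : ∀ j : ℕ, ∃ Cw δw : ℝ, 0 < δw ∧ VertexFamily₂ (𝒲Δ j) (Lc ^ (j + 1)) Cw δw)
    (hlawΔ : ∀ j : ℕ, 1 ≤ j → ∀ (μ ν : Fin 4) (z : Fin 4 → ℤ),
      hessKer (ANs Rt Ψs j) (VNs Rt Ψs hΨ P j) (WNsG Rt Ψs hΨ P j + 𝒲Δ j) μ ν z
        = hessKer (AF j) (𝒱F j) (𝒲F j) μ ν z + hessKer (AG j) (𝒱G j) (𝒲G j) μ ν z)
    (hF₁ : ∀ (μ ν : Fin 4) (z : Fin 4 → ℤ),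
      hessKer (AF 1) (𝒱F 1) (𝒲F 1) μ ν z
        = (Lc : ℝ) ^ 8 * dressedEntry (wStep Lc 1) (TshotOf Lc Jc 1) ((Lc : ℤ) • z) μ ν)
    (htr : ∀ j : ℕ, 1 ≤ j → ∀ (μ ν : Fin 4) (z : Fin 4 → ℤ),
      hessKer (AF (j + 1)) (𝒱F (j + 1)) (𝒲F (j + 1)) μ ν z
        = (Lc : ℝ) ^ 8 * dressedEntry (wStep Lc (j + 1)) (hessKer (ANs Rt Ψs j) (VNs Rt Ψs hΨ P j) (WNsG Rt Ψs hΨ P j)) ((Lc : ℤ) • z) μ ν)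
    (hG : ∀ j : ℕ, 1 ≤ j → ∀ (μ ν : Fin 4) (z : Fin 4 → ℤ),
      hessKer (AG j) (𝒱G j) (𝒲G j) μ ν z = TbalOf Lc (JsB12CombShSym hLc N (symTablesAn1S2 3 Lc cΛ) cΛ cB) j μ ν z)
    (hT0 : ∀ j (c e : Fin 4), HasSum (TbalOf Lc (JsB12CombShSym hLc N (symTablesAn1S2 3 Lc cΛ) cΛ cB) j c e) 0)
    (hT1 : ∀ j (c e ρ : Fin 4), HasSum (fun t : Fin 4 → ℤ => t ρ • TbalOf Lc (JsB12CombShSym hLc N (symTablesAn1S2 3 Lc cΛ) cΛ cB) j c e t) 0)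
    (S : ℕ → Fin (3 + 1) → Site (3 + 1) → Fin (3 + 1) → Site (3 + 1) → ℝ) (τ : ∀ j : ℕ, Fin (3 + 1) → Site (3 + 1) → V j →ₗ[ℝ] ℝ)
    (lam : ∀ j : ℕ, Fin (3 + 1) → Site (3 + 1) → V j)
    (c : Fin (3 + 1) → Site (3 + 1) →+ ℝ) (hcz : ∀ (ρ : Fin (3 + 1)) (z : Site (3 + 1)), c ρ z = (z ρ : ℝ))
    (hS : ∀ j (ν : Fin (3 + 1)) (z : Site (3 + 1)) (κ : Fin (3 + 1)) (y : Site (3 + 1)), S j ν z κ y = S j ν 0 κ (y - z))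
    (hτ : ∀ j (κ : Fin (3 + 1)) (y : Site (3 + 1)) (μ : Fin (3 + 1)) (z : Site (3 + 1)), τ j κ y (lam j μ z) = τ j κ (y - z) (lam j μ 0))
    (hSa : ∀ j (ν κ : Fin (3 + 1)), AbsMoment₂ (fun w => S j ν 0 κ w)) (hτa : ∀ j (κ μ : Fin (3 + 1)), AbsMoment₂ (fun y => τ j κ y (lam j μ 0)))
    (hΘ : ∀ j (κ μ : Fin (3 + 1)), ∑' y, τ j κ y (lam j μ 0) = 0)
    (hS0 : ∀ j (ν κ : Fin (3 + 1)), ∑' w, S j ν 0 κ w = 0)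
    (hS1 : ∀ j (ρ ν κ : Fin (3 + 1)), ∑' w, c ρ w * S j ν 0 κ w = 0)
    (hX : ∀ j : ℕ, 1 ≤ j → ∀ (μ ν : Fin (3 + 1)) (z : Site (3 + 1)),
      tadpole (ANs Rt Ψs j) (𝒲Δ j μ 0 ν z) = ∑ κ, ∑' y, (S j ν z κ y * τ j κ y (lam j μ 0) + S j μ 0 κ y * τ j κ y (lam j ν z))) :
    D1Tel Lc (JsB12CombShSym hLc N (symTablesAn1S2 3 Lc cΛ) cΛ cB) Jc := by
  have hc1 : ∀ (ρ : Fin (3 + 1)) (z : Site (3 + 1)), |c ρ z| ≤ 1 * l1 z := abs_coordHom_le_l1 c hcz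
  refine d1Tel_JcS_nestedG_of_fedW_moments_wStep hLc N cΛ cB Rt Ψs hΨ P Jc hJc1 hN AF 𝒱F 𝒲F AG 𝒱G 𝒲G 𝒲Δ hWΔ₂ hlawΔ hF₁ htr hG hT0 hT1
    (fun j hj μ ν => tsum_tadpole_eq_zero_of_tsum
      (tsum_symPairing_eq_zero (S j) (τ j) (lam j) (hS j) (hτ j) (hSa j) (hτa j) (hΘ j) μ ν) (hX j hj μ ν))
    (fun j hj μ ν ρ => ?_) (fun j hj κ l μ ν => ?_)
  · have h := tsum_firstMoment_symPairing_eq_zero_of_colSums_eq_zero (S j) (τ j) (lam j) (hS j) (hτ j) (hSa j) (hτa j) (hΘ j) (hS0 j)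
      (c ρ) zero_le_one (hc1 ρ) μ ν
    simp only [hcz] at h
    exact tsum_weight_tadpole_eq_zero_of_hasSum h (hX j hj μ ν)
  · have h := tsum_secondMoment_symPairing_eq_zero_of_dipoles_eq_zero (S j) (τ j) (lam j) (hS j) (hτ j) (hSa j) (hτa j) (hΘ j) (hS0 j)
      (c κ) (c l) zero_le_one zero_le_one (hc1 κ) (hc1 l) (hS1 j κ) (hS1 j l) μ ν
    simp only [hcz] at h
    exact tsum_weight_tadpole_eq_zero_of_hasSum h (hX j hj μ ν)

/-- [folklore] **THE PER-STOREY END, SUMMABLE CUT, WITH (U)(C)(R) THEMSELVES** at every storey (storey-indexed `hdiv j`, mirrors `R j ν ρ`, offsets `k j ν ρ`; `e`, `c` storey-free). -/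
theorem d1Tel_JcS_nestedG_of_fedW_pairingCoclosed_wStep (hLc : Odd Lc) (N : ℕ) (cΛ cB : ℝ) (Rt : Roots Lc) (Ψs : ℕ → MKer (3 + 1) (Fib 3)) (hΨ : ∀ m, Spr (Ψs m)) (P : Pins)
    (Jc : ∀ m : ℕ, JetData 3 (Lc ^ m)) (hJc1 : Jc 1 = JcOf hLc N (fun _ => cΛ) (fun _ => cB) 1)
    (hN : ∀ j : ℕ, 1 ≤ j → ∀ (a b : Fin 4) (z : Fin 4 → ℤ), hessKer (ANs Rt Ψs j) (VNs Rt Ψs hΨ P j) (WNsG Rt Ψs hΨ P j) a b z = TshotOf Lc Jc (j + 1) a b z)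
    (AF : ℕ → MKer 4 FF) (𝒱F : ℕ → Fin 4 → (Fin 4 → ℤ) → MKer 4 FF) (𝒲F : ℕ → Fin 4 → (Fin 4 → ℤ) → Fin 4 → (Fin 4 → ℤ) → MKer 4 FF)
    (AG : ℕ → MKer 4 FG) (𝒱G : ℕ → Fin 4 → (Fin 4 → ℤ) → MKer 4 FG) (𝒲G : ℕ → Fin 4 → (Fin 4 → ℤ) → Fin 4 → (Fin 4 → ℤ) → MKer 4 FG)
    (𝒲Δ : ℕ → Fin (3 + 1) → Site (3 + 1) → Fin (3 + 1) → Site (3 + 1) → MKer (3 + 1) (Fib 3))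
    (hWΔ₂ : ∀ j : ℕ, ∃ Cw δw : ℝ, 0 < δw ∧ VertexFamily₂ (𝒲Δ j) (Lc ^ (j + 1)) Cw δw)
    (hlawΔ : ∀ j : ℕ, 1 ≤ j → ∀ (μ ν : Fin 4) (z : Fin 4 → ℤ),
      hessKer (ANs Rt Ψs j) (VNs Rt Ψs hΨ P j) (WNsG Rt Ψs hΨ P j + 𝒲Δ j) μ ν z
        = hessKer (AF j) (𝒱F j) (𝒲F j) μ ν z + hessKer (AG j) (𝒱G j) (𝒲G j) μ ν z)
    (hF₁ : ∀ (μ ν : Fin 4) (z : Fin 4 → ℤ),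
      hessKer (AF 1) (𝒱F 1) (𝒲F 1) μ ν z
        = (Lc : ℝ) ^ 8 * dressedEntry (wStep Lc 1) (TshotOf Lc Jc 1) ((Lc : ℤ) • z) μ ν)
    (htr : ∀ j : ℕ, 1 ≤ j → ∀ (μ ν : Fin 4) (z : Fin 4 → ℤ),
      hessKer (AF (j + 1)) (𝒱F (j + 1)) (𝒲F (j + 1)) μ ν z
        = (Lc : ℝ) ^ 8 * dressedEntry (wStep Lc (j + 1)) (hessKer (ANs Rt Ψs j) (VNs Rt Ψs hΨ P j) (WNsG Rt Ψs hΨ P j)) ((Lc : ℤ) • z) μ ν)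
    (hG : ∀ j : ℕ, 1 ≤ j → ∀ (μ ν : Fin 4) (z : Fin 4 → ℤ),
      hessKer (AG j) (𝒱G j) (𝒲G j) μ ν z = TbalOf Lc (JsB12CombShSym hLc N (symTablesAn1S2 3 Lc cΛ) cΛ cB) j μ ν z)
    (hT0 : ∀ j (c e : Fin 4), HasSum (TbalOf Lc (JsB12CombShSym hLc N (symTablesAn1S2 3 Lc cΛ) cΛ cB) j c e) 0)
    (hT1 : ∀ j (c e ρ : Fin 4), HasSum (fun t : Fin 4 → ℤ => t ρ • TbalOf Lc (JsB12CombShSym hLc N (symTablesAn1S2 3 Lc cΛ) cΛ cB) j c e t) 0)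
    (S : ℕ → Fin (3 + 1) → Site (3 + 1) → Fin (3 + 1) → Site (3 + 1) → ℝ) (τ : ∀ j : ℕ, Fin (3 + 1) → Site (3 + 1) → V j →ₗ[ℝ] ℝ)
    (lam : ∀ j : ℕ, Fin (3 + 1) → Site (3 + 1) → V j)
    (c : Fin (3 + 1) → Site (3 + 1) →+ ℝ) (hcz : ∀ (ρ : Fin (3 + 1)) (z : Site (3 + 1)), c ρ z = (z ρ : ℝ))
    (e : Fin (3 + 1) → Site (3 + 1)) (hce : ∀ (ρ κ : Fin (3 + 1)), c ρ (e κ) = if κ = ρ then 1 else 0)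
    (hS : ∀ j (ν : Fin (3 + 1)) (z : Site (3 + 1)) (κ : Fin (3 + 1)) (y : Site (3 + 1)), S j ν z κ y = S j ν 0 κ (y - z))
    (hτ : ∀ j (κ : Fin (3 + 1)) (y : Site (3 + 1)) (μ : Fin (3 + 1)) (z : Site (3 + 1)), τ j κ y (lam j μ z) = τ j κ (y - z) (lam j μ 0))
    (hSa : ∀ j (ν κ : Fin (3 + 1)), AbsMoment₂ (fun w => S j ν 0 κ w)) (hτa : ∀ j (κ μ : Fin (3 + 1)), AbsMoment₂ (fun y => τ j κ y (lam j μ 0)))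
    (hΘ : ∀ j (κ μ : Fin (3 + 1)), ∑' y, τ j κ y (lam j μ 0) = 0)
    (hdiv : ∀ j (ν : Fin (3 + 1)) (y : Site (3 + 1)), ∑ κ, (S j ν 0 κ y - S j ν 0 κ (y - e κ)) = 0)
    (R : ℕ → Fin (3 + 1) → Fin (3 + 1) → Site (3 + 1) ≃ Site (3 + 1)) (k : ℕ → Fin (3 + 1) → Fin (3 + 1) → ℝ)
    (hRA : ∀ j (ν ρ : Fin (3 + 1)), ρ ≠ ν → ∀ κ, κ ≠ ρ → ∀ w, S j ν 0 κ (R j ν ρ w) = S j ν 0 κ w)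
    (hRc : ∀ j (ν ρ : Fin (3 + 1)), ρ ≠ ν → ∀ w, c ρ (R j ν ρ w) = k j ν ρ - c ρ w)
    (hX : ∀ j : ℕ, 1 ≤ j → ∀ (μ ν : Fin (3 + 1)) (z : Site (3 + 1)),
      tadpole (ANs Rt Ψs j) (𝒲Δ j μ 0 ν z) = ∑ κ, ∑' y, (S j ν z κ y * τ j κ y (lam j μ 0) + S j μ 0 κ y * τ j κ y (lam j ν z))) :
    D1Tel Lc (JsB12CombShSym hLc N (symTablesAn1S2 3 Lc cΛ) cΛ cB) Jc := by
  have hc1 : ∀ (ρ : Fin (3 + 1)) (z : Site (3 + 1)), |c ρ z| ≤ 1 * l1 z := abs_coordHom_le_l1 c hcz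
  have hS0 : ∀ j (ν κ : Fin (3 + 1)), ∑' w, S j ν 0 κ w = 0 := fun j ν κ =>
    tsum_col_eq_zero_of_coclosed e (fun κ' w => S j ν 0 κ' w) (hSa j ν) (hdiv j ν) (c κ) zero_le_one (hc1 κ) κ (hce κ)
  have hS1 : ∀ j (ρ ν κ : Fin (3 + 1)), ∑' w, c ρ w * S j ν 0 κ w = 0 := fun j ρ ν κ =>
    tsum_dipoles_eq_zero_of_coclosed_of_reflect e (fun κ' w => S j ν 0 κ' w) (hSa j ν) (hdiv j ν) c zero_le_one hc1 hce ν (R j ν) (hRA j ν) (k j ν)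
      (hRc j ν) ρ κ
  exact d1Tel_JcS_nestedG_of_fedW_pairingSummable_wStep hLc N cΛ cB Rt Ψs hΨ P Jc hJc1 hN AF 𝒱F 𝒲F AG 𝒱G 𝒲G 𝒲Δ hWΔ₂ hlawΔ hF₁ htr hG hT0 hT1
    S τ lam c hcz hS hτ hSa hτa hΘ hS0 hS1 hX

/- (II) JUNCTION for §2: every statement here is the ungraded `TowerFTransportRowSym` §2's with the ONE token `WNs ↦ WNsG` (proofs VERBATIM, `loc_WNs ↦ loc_WNsG`); at the ungraded
tables the ungraded file's own (II) reduces further to v10's supplier `d1Tel_JcComp_nested_of_fedW_pairingCoclosed_wStep` (not re-elaborated here). -/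

end EndChainL
end Summit.QuantumFields.BalabanUV.Beta.FP.TowerFTransportRowSymG

end
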